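import Mathlib
import HarnessLib
import HarnessLib.Audit
import Summits.Langlands.Langlands.Theorems.JDegreeFilterSplit


/-!
# DyadicDoorSplit (Prelude) — lens-5 g28 node on LJR = `JDegreeFilterSplit.LargeJResidual`
Census-twin landing of `HOME/nodes/lens-5-g28-DyadicDoorSplit.lean` (sha256 5d8e3514c860…, 513 l), SPLIT VERBATIM at §5 into two Theorems files for the
gate's 400-line lint (census-1 g30; crit-1 g9 CLEARED row 414, no conditions); one namespace, bodies concatenating to the node body; no text changed.
This part covers §1–§4 (dial, Allen junction, pieces, kernel).  The full module docstring of the node is kept in the Prelude.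

# DyadicDoorSplit — lens-5 g28 node on LJR = `JDegreeFilterSplit.LargeJResidual`

TARGET (BY NAME, tree decl, p824984): `Summit.Langlands.Langlands.Theorems.JDegreeFilterSplit.LargeJResidual`
(LJR) — the DECLARED RESIDUAL · IDEA-NEEDED of the landed g27 node `JDegreeFilterSplit` (crit row 401):
«every integral elliptic curve `E` (`Δ ≠ 0`) over an unanchored totally real field `K₀` of degree `≥ 6`
whose field of moduli `ℚ(j)` has degree `≥ 5` (or `4` with `√5 ∈ ℚ(j)`) is modular».  LJR refines
REST_E = `DepthIsolationSplit.UnanchoredHighDegreeModularE` (the type of the registered stub `stub_unanchored`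
of REST = `TowerDoorSplit.UnanchoredHighDegreeWitnessAutomorphy`, stmt-Langlands-26998), lineage g19 → g26 → g27.

AXIS (finite/base range + asymptotic regime + bridge), read at the prime `2` and at `∞` on the CURVE
(every earlier cut of this lineage was a FIELD or MODULI-DEGREE condition; the primes `3, 5, 7` are the
host's; the prime `2` is untouched on the REST box):

* dial = ALLEN'S DYADIC PREDICATE `AllenLocus K₀ E` — (a) `v(j_E) ≤ 0` at every `v ∣ 2`
  (potentially multiplicative or potentially ordinary: `1 ≤ v.valuation K₀ j`); (b₁) no `K₀`-rational
  `2`-torsion (the `2`-division cubic `4x³ + b₂x² + 2b₄x + b₆` — Mathlib's `twoTorsionPolynomial`, whose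
  discriminant is `16 Δ` — has no root in `K₀`); (b₂) `Δ ∉ K₀²`; (c) if `Δ` is totally negative then
  `Δ ∉ (K₀ᵥ)²` for some `v ∣ 2`.  All four are invariants of `E / K₀` (independent of the model:
  Allen, arXiv:1301.1113, p. 4, «the assumptions of the corollary are insensitive to the choice of
  Weierstrass equation»);
* GENERIC / ASYMPTOTIC REGIME = the door sector ADS `AllenDoorSector` (LJR on the Allen locus): PRINT modulo
  the junction ADC `AllenDyadicCorollary` = P. B. Allen, *Modularity of nearly ordinary 2-adic residually
  dihedral Galois representations*, Compositio Math. 150 (2014) 1235–1346, COROLLARY of the Introduction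
  (arXiv:1301.1113 p. 4), stated for EVERY totally real field `F`: (a) ∧ (b₁) ∧ (b₂) ∧ (c) ⟹ `E` modular.
  The tree vendors only the `F = ℚ` Galois-level main theorem
  (`Literature.NumberTheory.Automorphic.Allen2014_modularity_nearlyOrdinaryDihedral_Q`, with
  `-- TODO(general form)`); the E-level corollary over a general totally real field is typed HERE verbatim
  (typer request T1) — kernel `allenDoorSector_of_corollary : ADC → ADS`;
* LOW-COMPLEXITY / FINITE RANGE = the `2`-DEGENERATE curves, the DECLARED RESIDUAL
  `DyadicDegenerateResidual` (LJR off the Allen locus), split EXACTLY (`residual_iff_subloci`) into four typed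
  sub-loci with separate print status: R_tors `RationalTwoTorsionResidual` (a `K₀`-rational `2`-torsion point:
  `ρ̄_{E,2}` reducible — residually reducible at `2` over a general totally real field: NO print; Thorne 2026
  Thm B gives potential modularity only, Thm D is `F = ℚ`), R_sq `SquareDiscResidual` (`Δ ∈ K₀²`: image `C₃`
  or trivial — idem), R_ss `SupersingularAtTwoResidual` (`v(j) > 0` at some `v ∣ 2`: potentially supersingular
  at a dyadic place with SOLVABLE residual image — Kisin's `2`-adic Barsotti–Tate theorem and [KW2] exclude the
  residually solvable case, Allen p. 4; NO print), R_cm `CMComponentResidual` (`Δ` totally negative and a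
  dyadic square everywhere: Allen's condition (5) fails — «Hida's universal nearly ordinary Hecke algebra has
  CM components», p. 4; NO print);
* BRIDGE (orbit closure, §5): the sign pattern of `Δ` at the real places, the square class of `Δ`, and
  `v(j) ≤ 0` are invariant under the cheap moves (quadratic twist: same `j`, `Δ ↦ θ⁶Δ`; totally real base
  change `K₀ → L`: `disc_baseChange`, `exists_realEmbedding_extends`, `discNonsquare_baseChange_of_neg`,
  `jNonposAtTwo_baseChange`): a curve of the Allen locus with `Δ` of MIXED SIGN keeps (a), (b₂), (c) over
  every totally real extension, and keeps (b₁) too (`noRationalTwoTorsion_baseChange_of_neg`: a cubic field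
  `K₀(x₁)` with a complex place above a real place where `Δ < 0` lies in no totally real field) — the mixed-sign
  Allen locus is ORBIT-CLOSED (summary theorem `allenLocus_baseChange_of_mixedSign`, §6) and disjoint from
  the residual, so the residual is STRICTLY WEAKER than LJR modulo {⊗χ, totally real solvable base change +
  descent}.  Declared leaks (print cell redundant there, modulo
  DESC): `Δ` totally positive ⟹ `K₀(E[2])` is a totally real `S₃`-extension, base change lands in R_tors;
  `Δ` totally negative ⟹ a totally real quadratic `K₀(√m)`, `m ≡ Δ` in every `K₀ᵥˣ/(K₀ᵥˣ)²`, `v ∣ 2`, lands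
  in R_cm.

KERNEL (0 sorry; axioms expected [propext, Classical.choice, Quot.sound]):
`largeJResidual_iff_dyadic : LJR ↔ ADS ∧ RES` (excluded middle, no junction);
`residual_iff_subloci : RES ↔ R_tors ∧ R_sq ∧ R_ss ∧ R_cm` (de Morgan on the four clauses, no junction);
`allenDoorSector_of_corollary : ADC → ADS`; `largeJResidual_of_leaves : ADC → R_tors → R_sq → R_ss → R_cm → LJR`;
`restE_of_dyadicLeaves : DBC → NSBC → FLS2015_theorem1 → DNS2020_theorem4 → Box2022_theorem1_1 → ADC → R_tors →
R_sq → R_ss → R_cm → REST_E` (through the tree's `JDegreeFilterSplit.restE_of_jLeaves`); `closes_target : (same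
ten) → IMT → TRANY → W⁺|₂ → R1 → REST` BY NAME (through the tree's `JDegreeFilterSplit.closes_target`);
necessity = the sector projections of LJR.
-/

set_option linter.dupNamespace false
set_option linter.unusedVariables false

open scoped NumberField IntermediateField
open NumberField IsDedekindDomain Literature.NumberTheory.Automorphic
open Summit.Langlands.Langlands.Theorems.DepthIsolationSplit (UnanchoredBox UnanchoredHighDegreeModularE
  IntegralModelTransferPointwise SatakeAvatarTwo satakeAvatarTwo_of_host)
open Summit.Langlands.Langlands.Theorems.JDegreeFilterSplit (jInv jDeg InResidualRange LargeJResidual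
  RatBaseChangeModularity SmallFieldBaseChange restE_of_jLeaves rest_of_restE largeJResidual_of_restE
  jInv_baseChange algebraMap_baseChange_Δ)

namespace Summit.Langlands.Langlands.Theorems.DyadicDoorSplit

/-! ## §1 The dial: Allen's dyadic predicate -/

/-- The discriminant of the integral model, read in `K₀`. -/
noncomputable def disc (K₀ : Type) [Field K₀] [NumberField K₀] (E : WeierstrassCurve (𝓞 K₀)) : K₀ :=
  algebraMap (𝓞 K₀) K₀ E.Δ

/-- (a) `v(j_E) ≤ 0` at every place `v ∣ 2` of `K₀` (in Mathlib's multiplicative normalisation of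
`HeightOneSpectrum.valuation`: `1 ≤ v(j)`), i.e. `E` is potentially multiplicative or potentially ordinary at
every dyadic place. -/
def JNonposAtTwo (K₀ : Type) [Field K₀] [NumberField K₀] (E : WeierstrassCurve (𝓞 K₀)) : Prop :=
  ∀ v : HeightOneSpectrum (𝓞 K₀), (2 : 𝓞 K₀) ∈ v.asIdeal → 1 ≤ v.valuation K₀ (jInv K₀ E)

/-- (b₁) `E` has no `K₀`-rational point of order `2`: the `2`-division cubic `4x³ + b₂x² + 2b₄x + b₆`
(Mathlib `WeierstrassCurve.twoTorsionPolynomial`, discriminant `16 Δ`) has no root in `K₀` — a point `(x, y)`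
has order `2` iff `2y + a₁x + a₃ = 0` iff `x` is a root (Silverman, AEC III.2.3(d)). [folklore rendering] -/
def NoRationalTwoTorsion (K₀ : Type) [Field K₀] [NumberField K₀] (E : WeierstrassCurve (𝓞 K₀)) : Prop :=
  ∀ x : K₀, ¬ ((E.baseChange K₀).twoTorsionPolynomial).toPoly.IsRoot x

/-- (b₂) `Δ` is not a square in `K₀`. -/
def DiscNonsquare (K₀ : Type) [Field K₀] [NumberField K₀] (E : WeierstrassCurve (𝓞 K₀)) : Prop :=
  ¬ IsSquare (disc K₀ E)

/-- (c) if `Δ` is totally negative then `Δ` is a non-square in `K₀ᵥ` for some `v ∣ 2` (Allen's condition (5)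
for `ρ̄_{E,2}`: the quadratic field `K₀(√Δ)` cut out by `ρ̄` is then CM, and some dyadic place must not split
in it). -/
def AllenConditionC (K₀ : Type) [Field K₀] [NumberField K₀] (E : WeierstrassCurve (𝓞 K₀)) : Prop :=
  (∀ σ : K₀ →+* ℝ, σ (disc K₀ E) < 0) →
    ∃ v : HeightOneSpectrum (𝓞 K₀), (2 : 𝓞 K₀) ∈ v.asIdeal ∧
      ¬ IsSquare (algebraMap K₀ (v.adicCompletion K₀) (disc K₀ E))

/-- ALLEN'S DYADIC PREDICATE (the dial): (a) ∧ (b₁) ∧ (b₂) ∧ (c). -/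
def AllenLocus (K₀ : Type) [Field K₀] [NumberField K₀] (E : WeierstrassCurve (𝓞 K₀)) : Prop :=
  JNonposAtTwo K₀ E ∧ NoRationalTwoTorsion K₀ E ∧ DiscNonsquare K₀ E ∧ AllenConditionC K₀ E

/-! ## §2 The print junction: Allen 2014, Corollary, for every totally real field (E-level) -/

/-- ADC (PRINT junction; WEAKER; not yet vendored at this generality): **Allen 2014, Corollary of the
Introduction, verbatim for every totally real field.**  «Let `F` be a totally real field and let `E` be an
elliptic curve over `F` with `j`-invariant `j_E`.  Let `Δ` be the discriminant of some Weierstrass equation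
defining `E`.  Assume: for every `v ∣ 2` in `F`, the valuation of `j_E` at `v` is `≤ 0`; `E` has no `2`-torsion
defined over `F` and `Δ` is not a square in `F`; if `Δ` is totally negative, then there is some `v ∣ 2` in `F`
such that `Δ` is not a square in `F_v`.  Then `E` is modular.» (arXiv:1301.1113, p. 4; proof §MainCorProof from
the main Theorem p. 3: (b₁)(b₂) ⟹ `ρ̄_{E,2} ↠ GL₂(𝔽₂) ≅ S₃` absolutely irreducible dihedral, (a) ⟹ nearly
ordinary at `v ∣ 2`, (c) ⟹ condition (5).)  Rendered on integral models `E / 𝓞 F` with `Δ ≠ 0`, conclusion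
the tree's `IsModularEllipticCurve` (Caraiani–Newton sense; weaker than Allen's `ρ_{E,2} ≅ ρ_π`).  The tree's
`Allen2014_modularity_nearlyOrdinaryDihedral_Q` is the `F = ℚ` Galois-level theorem only.
[ref: Allen2014, Corollary p. 4 (arXiv:1301.1113); Compositio Math. 150 (2014) 1235–1346] -/
def AllenDyadicCorollary : Prop :=
  ∀ (K : Type) [Field K] [NumberField K] [IsTotallyReal K] (E : WeierstrassCurve (𝓞 K)), E.Δ ≠ 0 →
    AllenLocus K E → IsModularEllipticCurve K E

/-! ## §3 The pieces of LJR -/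

/-- ADS (generic regime; WEAKER; PRINT modulo ADC): LJR on the Allen locus — every integral `E` over an
unanchored totally real field of degree `≥ 6`, of residual moduli degree, satisfying Allen's dyadic predicate,
is modular. -/
def AllenDoorSector : Prop :=
  ∀ (K₀ : Type) [Field K₀] [NumberField K₀], UnanchoredBox K₀ →
    ∀ E : WeierstrassCurve (𝓞 K₀), E.Δ ≠ 0 → InResidualRange K₀ E → AllenLocus K₀ E →
      IsModularEllipticCurve K₀ E

/-- RES (the DECLARED RESIDUAL; IDEA-NEEDED): LJR off the Allen locus — the `2`-degenerate curves. -/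
def DyadicDegenerateResidual : Prop :=
  ∀ (K₀ : Type) [Field K₀] [NumberField K₀], UnanchoredBox K₀ →
    ∀ E : WeierstrassCurve (𝓞 K₀), E.Δ ≠ 0 → InResidualRange K₀ E → ¬ AllenLocus K₀ E →
      IsModularEllipticCurve K₀ E

/-- R_tors (residual sub-locus; IDEA-NEEDED): LJR for curves with a `K₀`-rational `2`-torsion point
(`ρ̄_{E,2}` reducible). -/
def RationalTwoTorsionResidual : Prop :=
  ∀ (K₀ : Type) [Field K₀] [NumberField K₀], UnanchoredBox K₀ →
    ∀ E : WeierstrassCurve (𝓞 K₀), E.Δ ≠ 0 → InResidualRange K₀ E →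
      (∃ x : K₀, ((E.baseChange K₀).twoTorsionPolynomial).toPoly.IsRoot x) → IsModularEllipticCurve K₀ E

/-- R_sq (residual sub-locus; IDEA-NEEDED): LJR for curves with square discriminant (`ρ̄_{E,2}` of image
`⊆ C₃`). -/
def SquareDiscResidual : Prop :=
  ∀ (K₀ : Type) [Field K₀] [NumberField K₀], UnanchoredBox K₀ →
    ∀ E : WeierstrassCurve (𝓞 K₀), E.Δ ≠ 0 → InResidualRange K₀ E → IsSquare (disc K₀ E) →
      IsModularEllipticCurve K₀ E

/-- R_ss (residual sub-locus; IDEA-NEEDED): LJR for curves with `v(j) > 0` at some `v ∣ 2` (potentially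
supersingular at a dyadic place). -/
def SupersingularAtTwoResidual : Prop :=
  ∀ (K₀ : Type) [Field K₀] [NumberField K₀], UnanchoredBox K₀ →
    ∀ E : WeierstrassCurve (𝓞 K₀), E.Δ ≠ 0 → InResidualRange K₀ E →
      (∃ v : HeightOneSpectrum (𝓞 K₀), (2 : 𝓞 K₀) ∈ v.asIdeal ∧ v.valuation K₀ (jInv K₀ E) < 1) →
      IsModularEllipticCurve K₀ E

/-- R_cm (residual sub-locus; IDEA-NEEDED): LJR for curves with `Δ` totally negative and a square in every
`K₀ᵥ`, `v ∣ 2` (Allen's condition (5) fails: the CM components of the nearly ordinary Hecke algebra). -/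
def CMComponentResidual : Prop :=
  ∀ (K₀ : Type) [Field K₀] [NumberField K₀], UnanchoredBox K₀ →
    ∀ E : WeierstrassCurve (𝓞 K₀), E.Δ ≠ 0 → InResidualRange K₀ E →
      (∀ σ : K₀ →+* ℝ, σ (disc K₀ E) < 0) →
      (∀ v : HeightOneSpectrum (𝓞 K₀), (2 : 𝓞 K₀) ∈ v.asIdeal →
        IsSquare (algebraMap K₀ (v.adicCompletion K₀) (disc K₀ E))) →
      IsModularEllipticCurve K₀ E

/-! ## §4 Kernel: exactness, the print cell, compositions by name -/

/-- EXACTNESS (no junction): LJR ⟺ ADS ∧ RES. -/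
theorem largeJResidual_iff_dyadic :
    LargeJResidual ↔ AllenDoorSector ∧ DyadicDegenerateResidual := by
  refine ⟨fun h => ⟨fun K₀ _ _ hb E hΔ hr _ => h K₀ hb E hΔ hr, fun K₀ _ _ hb E hΔ hr _ => h K₀ hb E hΔ hr⟩,
    ?_⟩
  rintro ⟨hA, hR⟩ K₀ _ _ hb E hΔ hr
  by_cases hL : AllenLocus K₀ E
  · exact hA K₀ hb E hΔ hr hL
  · exact hR K₀ hb E hΔ hr hL

/-- Off the Allen locus means: a rational `2`-torsion point, or a square discriminant, or a dyadic place with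
`v(j) > 0`, or (`Δ` totally negative and a dyadic square everywhere). -/
theorem not_allenLocus_iff (K₀ : Type) [Field K₀] [NumberField K₀] (E : WeierstrassCurve (𝓞 K₀)) :
    ¬ AllenLocus K₀ E ↔
      (∃ x : K₀, ((E.baseChange K₀).twoTorsionPolynomial).toPoly.IsRoot x) ∨ IsSquare (disc K₀ E) ∨
      (∃ v : HeightOneSpectrum (𝓞 K₀), (2 : 𝓞 K₀) ∈ v.asIdeal ∧ v.valuation K₀ (jInv K₀ E) < 1) ∨
      ((∀ σ : K₀ →+* ℝ, σ (disc K₀ E) < 0) ∧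
        ∀ v : HeightOneSpectrum (𝓞 K₀), (2 : 𝓞 K₀) ∈ v.asIdeal →
          IsSquare (algebraMap K₀ (v.adicCompletion K₀) (disc K₀ E))) := by
  unfold AllenLocus JNonposAtTwo NoRationalTwoTorsion DiscNonsquare AllenConditionC
  constructor
  · intro h
    by_cases hA : ∃ x : K₀, ((E.baseChange K₀).twoTorsionPolynomial).toPoly.IsRoot x
    · exact Or.inl hA
    by_cases hB : IsSquare (disc K₀ E)
    · exact Or.inr (Or.inl hB)
    by_cases hC : ∃ v : HeightOneSpectrum (𝓞 K₀), (2 : 𝓞 K₀) ∈ v.asIdeal ∧ v.valuation K₀ (jInv K₀ E) < 1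
    · exact Or.inr (Or.inr (Or.inl hC))
    refine Or.inr (Or.inr (Or.inr ?_))
    by_contra hD
    apply h
    refine ⟨fun v hv => ?_, fun x hx => hA ⟨x, hx⟩, hB, fun hneg => ?_⟩
    · exact not_lt.1 (fun hlt => hC ⟨v, hv, hlt⟩)
    · by_contra hno
      apply hD
      refine ⟨hneg, fun v hv => ?_⟩
      by_contra hns
      exact hno ⟨v, hv, hns⟩
  · rintro (⟨x, hx⟩ | hsq | ⟨v, hv, hlt⟩ | ⟨hneg, hall⟩) ⟨ha, hb1, hb2, hc⟩
    · exact hb1 x hx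
    · exact hb2 hsq
    · exact absurd (ha v hv) (not_le.2 hlt)
    · obtain ⟨v, hv, hns⟩ := hc hneg
      exact hns (hall v hv)

/-- EXACTNESS of the residual (no junction): RES ⟺ R_tors ∧ R_sq ∧ R_ss ∧ R_cm. -/
theorem residual_iff_subloci :
    DyadicDegenerateResidual ↔ RationalTwoTorsionResidual ∧ SquareDiscResidual ∧
      SupersingularAtTwoResidual ∧ CMComponentResidual := by
  constructor
  · intro h
    refine ⟨fun K₀ _ _ hb E hΔ hr hx => h K₀ hb E hΔ hr ((not_allenLocus_iff K₀ E).2 (Or.inl hx)),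
      fun K₀ _ _ hb E hΔ hr hsq => h K₀ hb E hΔ hr ((not_allenLocus_iff K₀ E).2 (Or.inr (Or.inl hsq))),
      fun K₀ _ _ hb E hΔ hr hv => h K₀ hb E hΔ hr ((not_allenLocus_iff K₀ E).2 (Or.inr (Or.inr (Or.inl hv)))),
      fun K₀ _ _ hb E hΔ hr hneg hall =>
        h K₀ hb E hΔ hr ((not_allenLocus_iff K₀ E).2 (Or.inr (Or.inr (Or.inr ⟨hneg, hall⟩))))⟩
  · rintro ⟨hT, hS, hV, hC⟩ K₀ _ _ hb E hΔ hr hnot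
    rcases (not_allenLocus_iff K₀ E).1 hnot with hx | hsq | hv | ⟨hneg, hall⟩
    · exact hT K₀ hb E hΔ hr hx
    · exact hS K₀ hb E hΔ hr hsq
    · exact hV K₀ hb E hΔ hr hv
    · exact hC K₀ hb E hΔ hr hneg hall

/-- THE PRINT CELL: Allen's corollary (every totally real field) gives the door sector on the REST box. -/
theorem allenDoorSector_of_corollary (hADC : AllenDyadicCorollary) : AllenDoorSector := by
  intro K₀ _ _ hb E hΔ _ hL
  haveI : IsTotallyReal K₀ := hb.1
  exact hADC K₀ E hΔ hL

/-- KERNEL (leaf level): ADC → R_tors → R_sq → R_ss → R_cm → LJR. -/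
theorem largeJResidual_of_leaves (hADC : AllenDyadicCorollary) (hT : RationalTwoTorsionResidual)
    (hS : SquareDiscResidual) (hV : SupersingularAtTwoResidual) (hC : CMComponentResidual) :
    LargeJResidual :=
  largeJResidual_iff_dyadic.2 ⟨allenDoorSector_of_corollary hADC, residual_iff_subloci.2 ⟨hT, hS, hV, hC⟩⟩

/-- KERNEL (sector level): ADS → RES → LJR. -/
theorem largeJResidual_of_sectors (hA : AllenDoorSector) (hR : DyadicDegenerateResidual) : LargeJResidual :=
  largeJResidual_iff_dyadic.2 ⟨hA, hR⟩

/-- KERNEL up to REST_E: the g27 leaves with LJR replaced by the dyadic leaves —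
DBC → NSBC → FLS → DNS → Box → ADC → R_tors → R_sq → R_ss → R_cm → REST_E (through the tree's
`JDegreeFilterSplit.restE_of_jLeaves`). -/
theorem restE_of_dyadicLeaves (hDBC : RatBaseChangeModularity) (hNSBC : SmallFieldBaseChange)
    (hFLS : FLS2015_theorem1) (hDNS : DNS2020_theorem4) (hBox : Box2022_theorem1_1)
    (hADC : AllenDyadicCorollary) (hT : RationalTwoTorsionResidual) (hS : SquareDiscResidual)
    (hV : SupersingularAtTwoResidual) (hC : CMComponentResidual) : UnanchoredHighDegreeModularE :=
  restE_of_jLeaves hDBC hNSBC hFLS hDNS hBox (largeJResidual_of_leaves hADC hT hS hV hC)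

/-- KERNEL COMPOSITION concluding REST = `TowerDoorSplit.UnanchoredHighDegreeWitnessAutomorphy`
(stmt-Langlands-26998) BY NAME: the ten leaves above, then IMT → TRANY (item 31038 by name) → W⁺|₂ → R1
(item 24805 by name), through the tree's `JDegreeFilterSplit.closes_target`. -/
theorem closes_target (hDBC : RatBaseChangeModularity) (hNSBC : SmallFieldBaseChange)
    (hFLS : FLS2015_theorem1) (hDNS : DNS2020_theorem4) (hBox : Box2022_theorem1_1)
    (hADC : AllenDyadicCorollary) (hT : RationalTwoTorsionResidual) (hS : SquareDiscResidual)
    (hV : SupersingularAtTwoResidual) (hC : CMComponentResidual)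
    (hIMT : IntegralModelTransferPointwise)
    (hTr : Summit.Langlands.Langlands.Theses.EllipticDegreeLadder.EllipticTransportAnyBase)
    (hW : SatakeAvatarTwo)
    (h1 : Summit.Langlands.Langlands.Theses.EllipticDegreeLadder.RankOneAutomorphy) :
    Summit.Langlands.Langlands.Theses.TowerDoorSplit.UnanchoredHighDegreeWitnessAutomorphy :=
  Summit.Langlands.Langlands.Theorems.JDegreeFilterSplit.closes_target hDBC hNSBC hFLS hDNS hBox
    (largeJResidual_of_leaves hADC hT hS hV hC) hIMT hTr hW h1

/-- `closes_target` with W⁺ the host item `SatakeAvatarExistence` (stmt-Langlands-17415) BY NAME. -/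
theorem closes_byName (hDBC : RatBaseChangeModularity) (hNSBC : SmallFieldBaseChange)
    (hFLS : FLS2015_theorem1) (hDNS : DNS2020_theorem4) (hBox : Box2022_theorem1_1)
    (hADC : AllenDyadicCorollary) (hT : RationalTwoTorsionResidual) (hS : SquareDiscResidual)
    (hV : SupersingularAtTwoResidual) (hC : CMComponentResidual)
    (hIMT : IntegralModelTransferPointwise)
    (hTr : Summit.Langlands.Langlands.Theses.EllipticDegreeLadder.EllipticTransportAnyBase)
    (hW : Summit.Langlands.Langlands.Theses.EllipticDegreeLadder.SatakeAvatarExistence)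
    (h1 : Summit.Langlands.Langlands.Theses.EllipticDegreeLadder.RankOneAutomorphy) :
    Summit.Langlands.Langlands.Theses.TowerDoorSplit.UnanchoredHighDegreeWitnessAutomorphy :=
  closes_target hDBC hNSBC hFLS hDNS hBox hADC hT hS hV hC hIMT hTr (satakeAvatarTwo_of_host hW) h1

/-! ### Necessity (the trivial direction): every piece is a sector projection of LJR, hence of REST_E -/

/-- NECESSITY: LJR ⇒ ADS. -/
theorem allenDoorSector_of_largeJResidual (h : LargeJResidual) : AllenDoorSector :=
  (largeJResidual_iff_dyadic.1 h).1

/-- NECESSITY: LJR ⇒ RES. -/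
theorem residual_of_largeJResidual (h : LargeJResidual) : DyadicDegenerateResidual :=
  (largeJResidual_iff_dyadic.1 h).2

/-- NECESSITY: LJR ⇒ each residual sub-locus. -/
theorem subloci_of_largeJResidual (h : LargeJResidual) :
    RationalTwoTorsionResidual ∧ SquareDiscResidual ∧ SupersingularAtTwoResidual ∧ CMComponentResidual :=
  residual_iff_subloci.1 (residual_of_largeJResidual h)

/-- NECESSITY: REST_E ⇒ every dyadic piece (through the tree's `largeJResidual_of_restE`). -/
theorem pieces_of_restE (h : UnanchoredHighDegreeModularE) :
    AllenDoorSector ∧ DyadicDegenerateResidual :=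
  largeJResidual_iff_dyadic.1 (largeJResidual_of_restE h)

end Summit.Langlands.Langlands.Theorems.DyadicDoorSplit
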